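import Literature.NumberTheory.LFunctions.CentralValueFamilyPigeonhole
import Literature.NumberTheory.LFunctions.IwaniecSarnakFamilyWeightTwoPetersson
import Literature.NumberTheory.LFunctions.IwaniecSarnakFamilySquareTower
import Literature.NumberTheory.LFunctions.Zhang2022.TypedSection01and02A
import Literature.NumberTheory.LFunctions.CentralValueForcedZeros
import HarnessLib

/-!
# From mollified moments to the ½-proportion edge shapes `EStarFam` / `UntwistedProportion`
# (Iwaniec–Sarnak 2000, the two Cauchy–Schwarz steps; Balkanova–Frolenkov 2021 §8.4)

Topic `Literature/NumberTheory/LFunctions` (namespace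
`Literature.NumberTheory.LFunctions.CentralValueFamilyHalfEdge`). PROVED bookkeeping over the cell's
family datum `CentralValueFamily`; six definitions with bodies (the mollified moments over the even
members and their window totals), NO named fact (D-0026). Cell `landau-siegel`, rung F-S3: §C typer-pool service for the §D/§G
birth packets at the third knife edge (the supports «moments ⇒ proportion» and «non-vanishing ⇒ value
floor» that every mollifier route to `EStarFam p a`, `p > ½`, must discharge).

## What is proved

For a datum `𝓕`, a parameter `P` and REAL mollifier values `M` on the forms at `P` write (sums over the
EVEN members `𝓕.evenForms P`, weights `ω_f = 𝓕.weight P f ≥ 0`, values `L_f = 𝓕.value P f ≥ 0`):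
`A₁ = Σ ω M L` (`mollFirst`), `A₂ = Σ ω M² L²` (`mollSecond`), `N = Σ ω M²` (`mollNorm`),
`W = 𝓕.evenMass P`, and `η = 𝓕.floor a P = (log |P|)⁻ᵃ`.

* `goodMass_ge_of_mollified` — the finite inequality
  `(A₁ − η √(W N))² ≤ 𝓕.goodMass a P · A₂` whenever `η √(W N) ≤ A₁`
  (r7's `CentralValueFamilyPigeonhole.weight_floor_ge_of_mollified`, p455844, instantiated on the even
  members; this is Balkanova–Frolenkov's «`Σ^h_{L_f ≥ b} 1 ≥ (M₁ − M̃₁)²/M₂`», §8.4).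
* `EStarFam_of_mollifiedMoments` — the ASYMPTOTIC form. If for every `ε > 0` and every large admissible
  `P` with positive even mass there are mollifier values `M_P` with `A₁ > 0`, Cauchy–Schwarz value
  `A₁² ≥ (r − ε) · W · A₂`, and negligible floor `η² · W · N ≤ ε² · A₁²`, then `𝓕.EStarFam p a` for every
  `p < r` (all three hypotheses are scale-free in the normalisation of `M` and of the weights).
* `untwistedProportion_of_mollifiedMoments` — the same for `𝓗_k(N)` in the record vocabulary
  (`IwaniecSarnak.harmonicSum`, even weight `k ≥ 2`, squarefree levels): harmonic mollified moments
  `Σʰ ω M L(½,f)`, `Σʰ ω M² L(½,f)²`, `Σʰ ω M²`, and the even harmonic mass `Σʰ_{w_f = 1} ω` with the three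
  scale-free conditions give `IwaniecSarnak.UntwistedProportion k r` — the (P)-row TARGET of the fam edge
  when `r = ½ + η` (the odd forms have `L(½,f) = 0`, so the first two sums may run over all newforms).
* `primeLevelFamilyTwo_EStarFam_of_mollifiedMoments` — prime levels, weight `2`: the same hypotheses at
  prime levels with `r > ½` give `∃ p₁ > ½, primeLevelFamilyTwo.EStarFam p₁ 2`, the socket of the
  weight-2 decision displays `lOne_lowerBound_of_EStarFam_prime_weightTwo` /`'`.
* `primeLevelFamilyTwo_EStarFam_of_mollifiedMoments_total` — the same with the Cauchy–Schwarz value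
  `v > ¼` measured against the TOTAL harmonic mass `Σʰ_{S₂(q)*} ω_f` (Kowalski–Michel–VanderKam's
  normalisation: «more than a quarter of all forms» = «more than half of the even ones»), the conversion
  `even mass ≤ (½ + o(1))·total mass` being the tree's `abs_two_mul_evenMass_sub_totalMass_le` /
  `abs_totalMass_sub_one_le` from the Petersson fact `kowalskiMichel2000_petersson` (p477278).
* `lOneLowerBound_four_of_mollifiedMoments_prime_weightTwo` / `theorem1_of_mollifiedMoments_prime_weightTwo`
  — the summit vocabulary: those moment hypotheses (`v > ¼`) together with the four printed facts of the
  weight-2 decision display (`lapidRallis2003_theorem1_gl2Twist`, `iwaniec2006_twistedHalf`,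
  `iwaniec2006_mixedMomentOverMass`, `kowalskiMichel2000_petersson`) give `Zhang2022.Skeleton.LOneLowerBound 4`
  and hence `Zhang2022.Skeleton.Theorem1` (`lOneLowerBound_of_eventual`, `Section1.lOneLowerBound_mono`).

* LEVEL-AVERAGED twins (the sockets of the window shapes `EStarFamLevelAvg`): `avgMollFirst`,
  `avgMollSecond`, `avgMollNorm` (window totals of the above), `avgGoodMass_ge_of_mollified` (window
  Cauchy–Schwarz with ONE uniform floor `η ≥` every level's floor), `EStarFamLevelAvg_of_mollifiedMomentsAvg`
  (per-ε scale-free conditions on the window totals ⇒ `𝓕.EStarFamLevelAvg win p a δ` for every `p < r`,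
  given `WindowBound`), and the record-vocabulary instance for every LEVEL CLASS datum
  `iwaniecSarnakFamilyOn k A` (`EStarFamLevelAvg_iwaniecSarnakFamilyOn_of_mollifiedMoments`: sums
  `Σ_{N ∈ win} Σʰ ω M_N L(½,f)` etc.), which serves the squarefree class (= `iwaniecSarnakFamily k`, e.g. the
  compatible window `ntWindow compatibleWindow`; `EStarFamLevelAvg_iwaniecSarnakFamily_of_mollifiedMoments`)
  and the square tower `SquareTower.towerFamily k` over `ntWindow towerWindow` alike
  (`towerEdge_of_mollifiedMoments`: value `r > ½ + η` ⇒ `SquareTower.TowerEdge k η δ`, the card's K1 ⇐ K2).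

WHAT THIS IS NOT: no moment asymptotic is asserted for any family; which mollifier values `M` and which
main terms realise the hypotheses (Kowalski–Michel–VanderKam at prime level for `Δ < 1`, giving `r < ½`;
a window beyond the diagonal for `r > ½`) is the business of the fact files / route items that CALL these
theorems. «The programme SEARCHES and TYPES; no claim about Landau–Siegel zeros, Theorems 1–2 of
arXiv:2211.02515 or a repaired Margin232 until a kernel theorem says so.»

## References

* [IwaniecSarnak2000] H. Iwaniec, P. Sarnak, *The non-vanishing of central values of automorphic
  L-functions and Landau–Siegel zeros*, Israel J. Math. 120 (2000) 155–177, Thm. 1 (method: mollified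
  first and second moment, Cauchy–Schwarz) (acq-11417).
* [BalkanovaFrolenkov2021] O. Balkanova, D. Frolenkov, *Moments of L-functions and the Liouville–Green
  method*, JEMS 23 (2021), §8.4, proof of Theorem 8.7 (held: paper:arxiv-1610.03465, chunk p0021) — the
  two Cauchy–Schwarz steps with the value floor `b(k)`.
* [IwaniecConversations2006] H. Iwaniec, LNM 1891 (2006), §7 (7.5) (the floor `(log N)⁻²`), p0097.
-/

noncomputable section

namespace Literature.NumberTheory.LFunctions.CentralValueFamilyHalfEdge

open scoped MatrixGroups
open Finset CongruenceSubgroup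
open Literature.NumberTheory.EllipticCurves.ModularForms
open Literature.NumberTheory.LFunctions.IwaniecSarnak
open Literature.NumberTheory.LFunctions.CentralValueFamilyPigeonhole

namespace CentralValueFamily

variable (𝓕 : CentralValueFamily)

/-! ## The mollified moments over the even members -/

/-- **Mollified first moment over the even members**: `A₁ = Σ_{f even} ω_f M(f) L(½,f)` for real
mollifier values `M` on the forms at `P` (Balkanova–Frolenkov's `M₁` restricted to `ε_f = 1`).
[cite: BalkanovaFrolenkov2021, §8.4 proof of Theorem 8.7] -/
def mollFirst (P : 𝓕.Param) (M : 𝓕.Form P → ℝ) : ℝ :=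
  ∑ f ∈ 𝓕.evenForms P, 𝓕.weight P f * M f * 𝓕.value P f

/-- **Mollified second moment over the even members**: `A₂ = Σ_{f even} ω_f M(f)² L(½,f)²`.
[cite: BalkanovaFrolenkov2021, §8.4 proof of Theorem 8.7] -/
def mollSecond (P : 𝓕.Param) (M : 𝓕.Form P → ℝ) : ℝ :=
  ∑ f ∈ 𝓕.evenForms P, 𝓕.weight P f * M f ^ 2 * 𝓕.value P f ^ 2

/-- **Second moment of the mollifier alone over the even members**: `N = Σ_{f even} ω_f M(f)²`.
[cite: BalkanovaFrolenkov2021, §8.4 proof of Theorem 8.7 (the factor `(Σ^h M²)^{1/2}`)] -/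
def mollNorm (P : 𝓕.Param) (M : 𝓕.Form P → ℝ) : ℝ :=
  ∑ f ∈ 𝓕.evenForms P, 𝓕.weight P f * M f ^ 2

variable {𝓕}

/-- Members of `evenForms` are members of `forms`. [folklore] -/
private theorem mem_forms_of_mem_evenForms' {P : 𝓕.Param} {f : 𝓕.Form P} (hf : f ∈ 𝓕.evenForms P) :
    f ∈ 𝓕.forms P := by
  classical
  exact (Finset.mem_filter.1 hf).1

/-- The second moment of the mollifier alone is non-negative (weights `≥ 0`).
[cite: BalkanovaFrolenkov2021, §8.4 proof of Theorem 8.7] -/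
theorem mollNorm_nonneg {P : 𝓕.Param} (M : 𝓕.Form P → ℝ)
    (hω : ∀ f ∈ 𝓕.forms P, 0 ≤ 𝓕.weight P f) : 0 ≤ 𝓕.mollNorm P M :=
  Finset.sum_nonneg fun f hf => mul_nonneg (hω f (mem_forms_of_mem_evenForms' hf)) (sq_nonneg _)

/-- The mollified second moment is non-negative (weights `≥ 0`).
[cite: BalkanovaFrolenkov2021, §8.4 proof of Theorem 8.7] -/
theorem mollSecond_nonneg {P : 𝓕.Param} (M : 𝓕.Form P → ℝ)
    (hω : ∀ f ∈ 𝓕.forms P, 0 ≤ 𝓕.weight P f) : 0 ≤ 𝓕.mollSecond P M :=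
  Finset.sum_nonneg fun f hf =>
    mul_nonneg (mul_nonneg (hω f (mem_forms_of_mem_evenForms' hf)) (sq_nonneg _)) (sq_nonneg _)

/-- **Cauchy–Schwarz**: `A₁² ≤ W · A₂` (weights `≥ 0`). [cite: BalkanovaFrolenkov2021, §8.4 proof of Theorem 8.7] -/
theorem mollFirst_sq_le {P : 𝓕.Param} (M : 𝓕.Form P → ℝ)
    (hω : ∀ f ∈ 𝓕.forms P, 0 ≤ 𝓕.weight P f) :
    𝓕.mollFirst P M ^ 2 ≤ 𝓕.evenMass P * 𝓕.mollSecond P M := by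
  unfold mollFirst evenMass mollSecond
  refine Finset.sum_sq_le_sum_mul_sum_of_sq_le_mul (𝓕.evenForms P)
    (r := fun f => 𝓕.weight P f * M f * 𝓕.value P f) (f := 𝓕.weight P)
    (g := fun f => 𝓕.weight P f * M f ^ 2 * 𝓕.value P f ^ 2)
    (fun f hf => hω f (mem_forms_of_mem_evenForms' hf))
    (fun f hf => mul_nonneg (mul_nonneg (hω f (mem_forms_of_mem_evenForms' hf)) (sq_nonneg _))
      (sq_nonneg _))
    (fun f _ => le_of_eq (by ring))

/-! ## The finite inequality (both Cauchy–Schwarz steps) -/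

/-- **Proportion with a value floor from mollified moments, on a family datum** (Iwaniec–Sarnak;
Balkanova–Frolenkov §8.4): with `A₁ = Σ_{even} ωML`, `A₂ = Σ_{even} ωM²L²`, `W = evenMass`,
`N = Σ_{even} ωM²` and the floor `η = (log |P|)⁻ᵃ ≥ 0`, if `η √(W N) ≤ A₁` then
`(A₁ − η √(W N))² ≤ goodMass a P · A₂` — i.e. the `ω`-mass of the even members with `L(½,f) ≥ η` is at
least `(A₁ − η √(WN))²/A₂`. (Instance of `CentralValueFamilyPigeonhole.weight_floor_ge_of_mollified`.)
[cite: BalkanovaFrolenkov2021, §8.4 proof of Theorem 8.7] [cite: IwaniecSarnak2000, Thm. 1 (method)] -/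
theorem goodMass_ge_of_mollified {a : ℕ} (P : 𝓕.Param) (M : 𝓕.Form P → ℝ)
    (hω : ∀ f ∈ 𝓕.forms P, 0 ≤ 𝓕.weight P f) (hL : ∀ f ∈ 𝓕.forms P, 0 ≤ 𝓕.value P f)
    (hη : 0 ≤ 𝓕.floor a P)
    (hA : 𝓕.floor a P * Real.sqrt (𝓕.evenMass P * 𝓕.mollNorm P M) ≤ 𝓕.mollFirst P M) :
    (𝓕.mollFirst P M - 𝓕.floor a P * Real.sqrt (𝓕.evenMass P * 𝓕.mollNorm P M)) ^ 2 ≤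
      𝓕.goodMass a P * 𝓕.mollSecond P M := by
  classical
  have h := weight_floor_ge_of_mollified (𝓕.evenForms P) (𝓕.weight P) (𝓕.value P) M
    (𝓕.floor a P) hη (fun f hf => hω f (mem_forms_of_mem_evenForms' hf))
    (fun f hf => hL f (mem_forms_of_mem_evenForms' hf)) hA
  exact h

/-- The value floor `(log |P|)⁻ᵃ` is non-negative once `|P| ≥ 1`. [cite: IwaniecConversations2006, §7 (7.5)] -/
theorem floor_nonneg_of_one_le {a : ℕ} {P : 𝓕.Param} (hP : 1 ≤ 𝓕.size P) : 0 ≤ 𝓕.floor a P := by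
  unfold floor
  exact inv_nonneg.mpr (pow_nonneg (Real.log_nonneg hP) _)

/-! ## The asymptotic form: mollified moments ⇒ `EStarFam` -/

/-- **MOLLIFIED MOMENTS ⇒ THE EDGE SHAPE** (the two supports «moments ⇒ Cauchy–Schwarz proportion»
and «non-vanishing ⇒ value floor» of every mollifier route to the ½-proportion edge, for an arbitrary
family datum). Assume `NonnegOn` (weights and central values `≥ 0`) and that for every `ε > 0`, for
all large admissible `P` with positive even mass, there are real mollifier values `M` on the forms at
`P` with
(1) `0 < A₁`;
(2) Cauchy–Schwarz value at least `r − ε`:  `(r − ε) · W · A₂ ≤ A₁²`;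
(3) negligible floor:  `η² · W · N ≤ ε² · A₁²`  (`η = (log |P|)⁻ᵃ`);
(`A₁, A₂, N` the mollified moments over the even members, `W` the even mass — all three conditions are
invariant under rescaling `M` and the weights). Then `𝓕.EStarFam p a` for every `p < r`: for all large
admissible `P`, `p · W ≤ goodMass a P`. Proof: `goodMass · A₂ ≥ (A₁ − η√(WN))² ≥ (1 − ε)² A₁² ≥
(1 − ε)²(r − ε) W A₂ ≥ p W A₂` and `A₂ > 0` by `A₁² ≤ W A₂`.
[cite: BalkanovaFrolenkov2021, §8.4 proof of Theorem 8.7] [cite: IwaniecSarnak2000, Thm. 1 (method)] -/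
theorem EStarFam_of_mollifiedMoments {a : ℕ} {r : ℝ} (hnn : 𝓕.NonnegOn)
    (H : ∀ ε : ℝ, 0 < ε → ∃ s₀ : ℝ, ∀ P : 𝓕.Param, 𝓕.Admissible P → s₀ ≤ 𝓕.size P →
      0 < 𝓕.evenMass P → ∃ M : 𝓕.Form P → ℝ,
        0 < 𝓕.mollFirst P M ∧
        (r - ε) * 𝓕.evenMass P * 𝓕.mollSecond P M ≤ 𝓕.mollFirst P M ^ 2 ∧
        𝓕.floor a P ^ 2 * 𝓕.evenMass P * 𝓕.mollNorm P M ≤ ε ^ 2 * 𝓕.mollFirst P M ^ 2)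
    {p : ℝ} (hp : p < r) : 𝓕.EStarFam p a := by
  by_cases hp0 : p ≤ 0
  · -- a non-positive proportion is free
    refine ⟨0, fun P _ _ => ?_⟩
    have hW : 0 ≤ 𝓕.evenMass P := 𝓕.evenMass_nonneg hnn P
    have hG : 0 ≤ 𝓕.goodMass a P :=
      Finset.sum_nonneg fun f hf => (hnn P f (mem_forms_of_mem_evenForms'
        (Finset.mem_of_mem_filter f hf))).1
    nlinarith
  push Not at hp0
  have hr : 0 < r := hp0.trans hp
  -- the slack
  set ε : ℝ := min (1 / 2) ((r - p) / (1 + 2 * r)) with hεdef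
  have hε : 0 < ε := lt_min (by norm_num) (div_pos (by linarith) (by linarith))
  have hε2 : ε ≤ 1 / 2 := min_le_left _ _
  have hεr : ε ≤ (r - p) / (1 + 2 * r) := min_le_right _ _
  have hεr' : ε * (1 + 2 * r) ≤ r - p := by rwa [le_div_iff₀ (by linarith)] at hεr
  have hrε : 0 < r - ε := by nlinarith
  -- the key numerical inequality `p ≤ (1 − ε)² (r − ε)`
  have hkey : p ≤ (1 - ε) ^ 2 * (r - ε) := by
    have e1 : (1 - 2 * ε) * (r - ε) = r - ε * (1 + 2 * r) + 2 * ε ^ 2 := by ring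
    have h1 : p ≤ (1 - 2 * ε) * (r - ε) := by rw [e1]; nlinarith [sq_nonneg ε]
    have h2 : (1 - 2 * ε) * (r - ε) ≤ (1 - ε) ^ 2 * (r - ε) :=
      mul_le_mul_of_nonneg_right (by nlinarith [sq_nonneg ε]) hrε.le
    exact h1.trans h2
  obtain ⟨s₀, hs₀⟩ := H ε hε
  refine ⟨max s₀ 1, fun P hadm hsz => ?_⟩
  have hs : s₀ ≤ 𝓕.size P := le_trans (le_max_left _ _) hsz
  have h1 : (1 : ℝ) ≤ 𝓕.size P := le_trans (le_max_right _ _) hsz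
  have hω : ∀ f ∈ 𝓕.forms P, 0 ≤ 𝓕.weight P f := fun f hf => (hnn P f hf).1
  have hL : ∀ f ∈ 𝓕.forms P, 0 ≤ 𝓕.value P f := fun f hf => (hnn P f hf).2.1
  have hW : 0 ≤ 𝓕.evenMass P := 𝓕.evenMass_nonneg hnn P
  have hG : 0 ≤ 𝓕.goodMass a P :=
    Finset.sum_nonneg fun f hf => (hnn P f (mem_forms_of_mem_evenForms'
      (Finset.mem_of_mem_filter f hf))).1
  rcases hW.eq_or_lt with hW0 | hWpos
  · rw [← hW0, mul_zero]; exact hG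
  obtain ⟨M, hA1, hCS, hfl⟩ := hs₀ P hadm hs hWpos
  set A₁ := 𝓕.mollFirst P M with hA₁def
  set A₂ := 𝓕.mollSecond P M with hA₂def
  set W := 𝓕.evenMass P with hWdef
  set N := 𝓕.mollNorm P M with hNdef
  set η := 𝓕.floor a P with hηdef
  have hη : 0 ≤ η := floor_nonneg_of_one_le h1
  have hN : 0 ≤ N := mollNorm_nonneg M hω
  have hA2 : 0 ≤ A₂ := mollSecond_nonneg M hω
  -- `η √(W N) ≤ ε A₁`
  have hsqrt : η * Real.sqrt (W * N) ≤ ε * A₁ := by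
    have e1 : η * Real.sqrt (W * N) = Real.sqrt (η ^ 2 * (W * N)) := by
      rw [Real.sqrt_mul (sq_nonneg η), Real.sqrt_sq hη]
    have e2 : ε * A₁ = Real.sqrt ((ε * A₁) ^ 2) := by
      rw [Real.sqrt_sq (mul_nonneg hε.le hA1.le)]
    rw [e1, e2]
    refine Real.sqrt_le_sqrt ?_
    calc η ^ 2 * (W * N) = η ^ 2 * W * N := by ring
      _ ≤ ε ^ 2 * A₁ ^ 2 := hfl
      _ = (ε * A₁) ^ 2 := by ring
  have hA : η * Real.sqrt (W * N) ≤ A₁ := by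
    refine hsqrt.trans ?_
    have : ε * A₁ ≤ 1 * A₁ := mul_le_mul_of_nonneg_right (by linarith) hA1.le
    linarith
  -- the finite inequality
  have hfin := goodMass_ge_of_mollified (a := a) P M hω hL hη hA
  -- `(1 − ε) A₁ ≤ A₁ − η √(W N)`
  have hlow : (1 - ε) * A₁ ≤ A₁ - η * Real.sqrt (W * N) := by linarith
  have hlow0 : 0 ≤ (1 - ε) * A₁ := mul_nonneg (by linarith) hA1.le
  have hsq : ((1 - ε) * A₁) ^ 2 ≤ (A₁ - η * Real.sqrt (W * N)) ^ 2 :=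
    pow_le_pow_left₀ hlow0 hlow 2
  -- `A₂ > 0`
  have hA1sq : A₁ ^ 2 ≤ W * A₂ := mollFirst_sq_le M hω
  have hA2pos : 0 < A₂ := by
    rcases hA2.eq_or_lt with h | h
    · exfalso
      rw [← h, mul_zero] at hA1sq
      nlinarith
    · exact h
  -- assemble: `p W A₂ ≤ goodMass A₂`
  have hchain : p * W * A₂ ≤ 𝓕.goodMass a P * A₂ := by
    have hWA : 0 ≤ W * A₂ := mul_nonneg hW hA2
    calc p * W * A₂ = p * (W * A₂) := by ring
      _ ≤ (1 - ε) ^ 2 * (r - ε) * (W * A₂) := mul_le_mul_of_nonneg_right hkey hWA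
      _ = (1 - ε) ^ 2 * ((r - ε) * W * A₂) := by ring
      _ ≤ (1 - ε) ^ 2 * A₁ ^ 2 := mul_le_mul_of_nonneg_left hCS (sq_nonneg _)
      _ = ((1 - ε) * A₁) ^ 2 := by ring
      _ ≤ (A₁ - η * Real.sqrt (W * N)) ^ 2 := hsq
      _ ≤ 𝓕.goodMass a P * A₂ := hfin
  exact le_of_mul_le_mul_right hchain hA2pos

/-! ## Level-averaged mollified moments (the window shapes) -/

section LevelAverage

variable (𝓕)

/-- **Window total of the mollified first moments**: `A₁ = Σ_{P ∈ W} Σ_{f even} ω_f M_P(f) L(½,f)` for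
level-dependent real mollifier values `M`. [cite: IwaniecConversations2006, §7 (7.5) and p0097:L15] -/
def avgMollFirst (W : Finset 𝓕.Param) (M : (P : 𝓕.Param) → 𝓕.Form P → ℝ) : ℝ :=
  ∑ P ∈ W, 𝓕.mollFirst P (M P)

/-- **Window total of the mollified second moments** `A₂ = Σ_{P ∈ W} Σ_{f even} ω_f M_P(f)² L(½,f)²`.
[cite: IwaniecConversations2006, §7 (7.5) and p0097:L15] -/
def avgMollSecond (W : Finset 𝓕.Param) (M : (P : 𝓕.Param) → 𝓕.Form P → ℝ) : ℝ :=
  ∑ P ∈ W, 𝓕.mollSecond P (M P)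

/-- **Window total of the mollifier second moments** `N = Σ_{P ∈ W} Σ_{f even} ω_f M_P(f)²`.
[cite: IwaniecConversations2006, §7 (7.5) and p0097:L15] -/
def avgMollNorm (W : Finset 𝓕.Param) (M : (P : 𝓕.Param) → 𝓕.Form P → ℝ) : ℝ :=
  ∑ P ∈ W, 𝓕.mollNorm P (M P)

variable {𝓕}

/-- A filtered sum over a sigma-window is the iterated filtered sum. [folklore] -/
private theorem sum_sigma_filter' (W : Finset 𝓕.Param) (t : (P : 𝓕.Param) → Finset (𝓕.Form P))
    (g : (P : 𝓕.Param) → 𝓕.Form P → ℝ) (q : (P : 𝓕.Param) → 𝓕.Form P → Prop)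
    [∀ P, DecidablePred (q P)] :
    ∑ x ∈ (W.sigma t) with q x.1 x.2, g x.1 x.2 = ∑ P ∈ W, ∑ f ∈ t P with q P f, g P f := by
  rw [Finset.sum_filter, Finset.sum_sigma]
  refine Finset.sum_congr rfl fun P _ => ?_
  rw [Finset.sum_filter]

/-- The window totals are non-negative under `NonnegOn`. [cite: IwaniecConversations2006, §7 (7.3)] -/
theorem avgMollNorm_nonneg (hnn : 𝓕.NonnegOn) (W : Finset 𝓕.Param)
    (M : (P : 𝓕.Param) → 𝓕.Form P → ℝ) : 0 ≤ 𝓕.avgMollNorm W M :=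
  Finset.sum_nonneg fun P _ => mollNorm_nonneg (M P) fun f hf => (hnn P f hf).1

/-- The window totals are non-negative under `NonnegOn`. [cite: IwaniecConversations2006, §7 (7.3)] -/
theorem avgMollSecond_nonneg (hnn : 𝓕.NonnegOn) (W : Finset 𝓕.Param)
    (M : (P : 𝓕.Param) → 𝓕.Form P → ℝ) : 0 ≤ 𝓕.avgMollSecond W M :=
  Finset.sum_nonneg fun P _ => mollSecond_nonneg (M P) fun f hf => (hnn P f hf).1

/-- The window even mass is non-negative under `NonnegOn`. [cite: IwaniecConversations2006, §7 (7.3)] -/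
theorem avgEvenMass_nonneg' (hnn : 𝓕.NonnegOn) (W : Finset 𝓕.Param) : 0 ≤ 𝓕.avgEvenMass W :=
  Finset.sum_nonneg fun P _ => 𝓕.evenMass_nonneg hnn P

/-- The window (7.5)-mass is non-negative under `NonnegOn`. [cite: IwaniecConversations2006, §7 (7.5)] -/
theorem avgGoodMass_nonneg' (hnn : 𝓕.NonnegOn) (a : ℕ) (W : Finset 𝓕.Param) :
    0 ≤ 𝓕.avgGoodMass a W :=
  Finset.sum_nonneg fun P _ => Finset.sum_nonneg fun f hf =>
    (hnn P f (mem_forms_of_mem_evenForms' (Finset.mem_of_mem_filter f hf))).1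

/-- **Cauchy–Schwarz over the window**: `A₁² ≤ (Σ evenMass) · A₂`. [cite: BalkanovaFrolenkov2021, §8.4 proof of Theorem 8.7] -/
theorem avgMollFirst_sq_le (hnn : 𝓕.NonnegOn) (W : Finset 𝓕.Param)
    (M : (P : 𝓕.Param) → 𝓕.Form P → ℝ) :
    𝓕.avgMollFirst W M ^ 2 ≤ 𝓕.avgEvenMass W * 𝓕.avgMollSecond W M := by
  classical
  have e1 : 𝓕.avgMollFirst W M =
      ∑ x ∈ W.sigma (fun P => 𝓕.evenForms P), 𝓕.weight x.1 x.2 * M x.1 x.2 * 𝓕.value x.1 x.2 := by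
    unfold avgMollFirst mollFirst; rw [Finset.sum_sigma]
  have e2 : 𝓕.avgEvenMass W = ∑ x ∈ W.sigma (fun P => 𝓕.evenForms P), 𝓕.weight x.1 x.2 := by
    unfold avgEvenMass evenMass; rw [Finset.sum_sigma]
  have e3 : 𝓕.avgMollSecond W M =
      ∑ x ∈ W.sigma (fun P => 𝓕.evenForms P), 𝓕.weight x.1 x.2 * M x.1 x.2 ^ 2 * 𝓕.value x.1 x.2 ^ 2 := by
    unfold avgMollSecond mollSecond; rw [Finset.sum_sigma]
  rw [e1, e2, e3]
  have hω : ∀ x ∈ W.sigma (fun P => 𝓕.evenForms P), 0 ≤ 𝓕.weight x.1 x.2 := fun x hx =>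
    (hnn x.1 x.2 (mem_forms_of_mem_evenForms' (Finset.mem_sigma.1 hx).2)).1
  exact Finset.sum_sq_le_sum_mul_sum_of_sq_le_mul _
    (r := fun x => 𝓕.weight x.1 x.2 * M x.1 x.2 * 𝓕.value x.1 x.2) (f := fun x => 𝓕.weight x.1 x.2)
    (g := fun x => 𝓕.weight x.1 x.2 * M x.1 x.2 ^ 2 * 𝓕.value x.1 x.2 ^ 2)
    hω (fun x hx => mul_nonneg (mul_nonneg (hω x hx) (sq_nonneg _)) (sq_nonneg _))
    (fun x _ => le_of_eq (by ring))

/-- **Proportion with a value floor from mollified moments, over a WINDOW of levels** (the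
level-averaged form of the two Cauchy–Schwarz steps): with the window totals `A₁, A₂, N`, the window
even mass `W` and ONE floor `η ≥ 0` dominating every level's floor (`(log |P|)⁻ᵃ ≤ η` on the window —
e.g. `η = (log X)⁻ᵃ` when `|P| ≥ X`), if `η √(W N) ≤ A₁` then `(A₁ − η √(W N))² ≤ avgGoodMass a W · A₂`.
(`CentralValueFamilyPigeonhole.weight_floor_ge_of_mollified` on the sigma-finset of the window, then
`{L ≥ η} ⊆ {L ≥ (log |P|)⁻ᵃ}` level by level.)
[cite: BalkanovaFrolenkov2021, §8.4 proof of Theorem 8.7] [cite: IwaniecConversations2006, §7 (7.5) and p0097:L15] -/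
theorem avgGoodMass_ge_of_mollified (hnn : 𝓕.NonnegOn) {a : ℕ} (W : Finset 𝓕.Param)
    (M : (P : 𝓕.Param) → 𝓕.Form P → ℝ) {η : ℝ} (hη : 0 ≤ η) (hfloor : ∀ P ∈ W, 𝓕.floor a P ≤ η)
    (hA : η * Real.sqrt (𝓕.avgEvenMass W * 𝓕.avgMollNorm W M) ≤ 𝓕.avgMollFirst W M) :
    (𝓕.avgMollFirst W M - η * Real.sqrt (𝓕.avgEvenMass W * 𝓕.avgMollNorm W M)) ^ 2 ≤
      𝓕.avgGoodMass a W * 𝓕.avgMollSecond W M := by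
  classical
  set s := W.sigma (fun P => 𝓕.evenForms P) with hsdef
  have hω : ∀ x ∈ s, 0 ≤ 𝓕.weight x.1 x.2 := fun x hx =>
    (hnn x.1 x.2 (mem_forms_of_mem_evenForms' (Finset.mem_sigma.1 hx).2)).1
  have hL : ∀ x ∈ s, 0 ≤ 𝓕.value x.1 x.2 := fun x hx =>
    (hnn x.1 x.2 (mem_forms_of_mem_evenForms' (Finset.mem_sigma.1 hx).2)).2.1
  have e1 : 𝓕.avgMollFirst W M = ∑ x ∈ s, 𝓕.weight x.1 x.2 * M x.1 x.2 * 𝓕.value x.1 x.2 := by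
    unfold avgMollFirst mollFirst; rw [Finset.sum_sigma]
  have e2 : 𝓕.avgEvenMass W = ∑ x ∈ s, 𝓕.weight x.1 x.2 := by
    unfold avgEvenMass evenMass; rw [Finset.sum_sigma]
  have e3 : 𝓕.avgMollSecond W M = ∑ x ∈ s, 𝓕.weight x.1 x.2 * M x.1 x.2 ^ 2 * 𝓕.value x.1 x.2 ^ 2 := by
    unfold avgMollSecond mollSecond; rw [Finset.sum_sigma]
  have e4 : 𝓕.avgMollNorm W M = ∑ x ∈ s, 𝓕.weight x.1 x.2 * M x.1 x.2 ^ 2 := by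
    unfold avgMollNorm mollNorm; rw [Finset.sum_sigma]
  have hA' : η * Real.sqrt ((∑ x ∈ s, 𝓕.weight x.1 x.2) * ∑ x ∈ s, 𝓕.weight x.1 x.2 * M x.1 x.2 ^ 2) ≤
      ∑ x ∈ s, 𝓕.weight x.1 x.2 * M x.1 x.2 * 𝓕.value x.1 x.2 := by
    rw [← e1, ← e2, ← e4]; exact hA
  have h := weight_floor_ge_of_mollified s (fun x => 𝓕.weight x.1 x.2) (fun x => 𝓕.value x.1 x.2)
    (fun x => M x.1 x.2) η hη hω hL hA'
  rw [← e1, ← e2, ← e3, ← e4] at h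
  refine h.trans (mul_le_mul_of_nonneg_right ?_ (avgMollSecond_nonneg hnn W M))
  -- `Σ_{(P,f) : η ≤ L} ω ≤ Σ_P Σ_{f : floor P ≤ L} ω = avgGoodMass`
  rw [hsdef, sum_sigma_filter' W (fun P => 𝓕.evenForms P) (fun P f => 𝓕.weight P f)
    (fun P f => η ≤ 𝓕.value P f)]
  unfold avgGoodMass goodMass
  refine Finset.sum_le_sum fun P hP => ?_
  refine Finset.sum_le_sum_of_subset_of_nonneg ?_ (fun f hf _ =>
    (hnn P f (mem_forms_of_mem_evenForms' (Finset.mem_of_mem_filter f hf))).1)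
  intro f hf
  rw [Finset.mem_filter] at hf ⊢
  exact ⟨hf.1, le_trans (hfloor P hP) hf.2⟩

/-- The real-arithmetic step shared by the pointwise and the averaged conversion: from the three
scale-free conditions at slack `ε = min (½, (r − p)/(1 + 2r))`, Cauchy–Schwarz `A₁² ≤ W A₂` and the
finite floor inequality, conclude `p·W ≤ G`. [cite: BalkanovaFrolenkov2021, §8.4 proof of Theorem 8.7] -/
private theorem ratio_step {p r ε A₁ A₂ W N G η : ℝ} (hp0 : 0 < p) (hp : p < r)
    (hε2 : ε ≤ 1 / 2) (hε : 0 < ε) (hεr' : ε * (1 + 2 * r) ≤ r - p)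
    (hW : 0 ≤ W) (hA2 : 0 ≤ A₂) (hη : 0 ≤ η)
    (hA1 : 0 < A₁) (hCS : (r - ε) * W * A₂ ≤ A₁ ^ 2) (hfl : η ^ 2 * W * N ≤ ε ^ 2 * A₁ ^ 2)
    (hA1sq : A₁ ^ 2 ≤ W * A₂)
    (hfin : η * Real.sqrt (W * N) ≤ A₁ → (A₁ - η * Real.sqrt (W * N)) ^ 2 ≤ G * A₂) :
    p * W ≤ G := by
  have hr : 0 < r := hp0.trans hp
  have hrε : 0 < r - ε := by nlinarith
  have hkey : p ≤ (1 - ε) ^ 2 * (r - ε) := by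
    have e1 : (1 - 2 * ε) * (r - ε) = r - ε * (1 + 2 * r) + 2 * ε ^ 2 := by ring
    have h1 : p ≤ (1 - 2 * ε) * (r - ε) := by rw [e1]; nlinarith [sq_nonneg ε]
    have h2 : (1 - 2 * ε) * (r - ε) ≤ (1 - ε) ^ 2 * (r - ε) :=
      mul_le_mul_of_nonneg_right (by nlinarith [sq_nonneg ε]) hrε.le
    exact h1.trans h2
  have hsqrt : η * Real.sqrt (W * N) ≤ ε * A₁ := by
    have e1 : η * Real.sqrt (W * N) = Real.sqrt (η ^ 2 * (W * N)) := by
      rw [Real.sqrt_mul (sq_nonneg η), Real.sqrt_sq hη]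
    have e2 : ε * A₁ = Real.sqrt ((ε * A₁) ^ 2) := by
      rw [Real.sqrt_sq (mul_nonneg hε.le hA1.le)]
    rw [e1, e2]
    refine Real.sqrt_le_sqrt ?_
    calc η ^ 2 * (W * N) = η ^ 2 * W * N := by ring
      _ ≤ ε ^ 2 * A₁ ^ 2 := hfl
      _ = (ε * A₁) ^ 2 := by ring
  have hA : η * Real.sqrt (W * N) ≤ A₁ := by
    refine hsqrt.trans ?_
    have : ε * A₁ ≤ 1 * A₁ := mul_le_mul_of_nonneg_right (by linarith) hA1.le
    linarith
  have hfin' := hfin hA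
  have hlow : (1 - ε) * A₁ ≤ A₁ - η * Real.sqrt (W * N) := by linarith
  have hlow0 : 0 ≤ (1 - ε) * A₁ := mul_nonneg (by linarith) hA1.le
  have hsq : ((1 - ε) * A₁) ^ 2 ≤ (A₁ - η * Real.sqrt (W * N)) ^ 2 := pow_le_pow_left₀ hlow0 hlow 2
  have hA2pos : 0 < A₂ := by
    rcases hA2.eq_or_lt with h | h
    · exfalso
      rw [← h, mul_zero] at hA1sq
      nlinarith
    · exact h
  have hchain : p * W * A₂ ≤ G * A₂ := by
    have hWA : 0 ≤ W * A₂ := mul_nonneg hW hA2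
    calc p * W * A₂ = p * (W * A₂) := by ring
      _ ≤ (1 - ε) ^ 2 * (r - ε) * (W * A₂) := mul_le_mul_of_nonneg_right hkey hWA
      _ = (1 - ε) ^ 2 * ((r - ε) * W * A₂) := by ring
      _ ≤ (1 - ε) ^ 2 * A₁ ^ 2 := mul_le_mul_of_nonneg_left hCS (sq_nonneg _)
      _ = ((1 - ε) * A₁) ^ 2 := by ring
      _ ≤ (A₁ - η * Real.sqrt (W * N)) ^ 2 := hsq
      _ ≤ G * A₂ := hfin'
  exact le_of_mul_le_mul_right hchain hA2pos

/-- On a window at scale `X ≥ 2` every level's floor is at most the uniform floor `(log X)⁻ᵃ`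
(`|P| ≥ X`). [cite: IwaniecConversations2006, §7 (7.5) and p0097:L15] -/
theorem floor_le_of_le_size {a : ℕ} {X : ℝ} (hX : 2 ≤ X) {P : 𝓕.Param} (hP : X ≤ 𝓕.size P) :
    𝓕.floor a P ≤ ((Real.log X) ^ a)⁻¹ := by
  unfold floor
  have hlogX : 0 < Real.log X := Real.log_pos (by linarith)
  have hle : Real.log X ≤ Real.log (𝓕.size P) := Real.log_le_log (by linarith) hP
  exact inv_anti₀ (pow_pos hlogX _) (pow_le_pow_left₀ hlogX.le hle _)

variable {win : ℝ → (D : ℕ) → DirichletCharacter ℂ D → Finset 𝓕.Param}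

/-- **LEVEL-AVERAGED MOLLIFIED MOMENTS ⇒ THE AVERAGED EDGE SHAPE `EStarFamLevelAvg`** (the socket
of the window targets: compatible window, level classes, square tower). Assume `NonnegOn`, a bounded
window scheme (`WindowBound win δ K`: every `P ∈ win X χ` admissible with `X ≤ |P| ≤ K X`), and that
for every `ε > 0`, for all large `X` and all real primitive `χ mod D`, `D ≤ X^δ`, whose window has
positive even mass, there are level-dependent real mollifier values `M` with window totals satisfying
(1) `0 < A₁`; (2) `(r − ε) · W · A₂ ≤ A₁²` (`W` = window even mass);
(3) `(log X)^{−2a} · W · N ≤ ε² · A₁²` (the uniform floor `(log X)⁻ᵃ` dominates every level's floor).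
Then `𝓕.EStarFamLevelAvg win p a δ` for every `p < r`. Nothing here asserts the hypotheses.
[cite: IwaniecConversations2006, §7 (7.5) and p0097:L15] [cite: BalkanovaFrolenkov2021, §8.4 proof of Theorem 8.7] -/
theorem EStarFamLevelAvg_of_mollifiedMomentsAvg {a : ℕ} {r δ K : ℝ} (hnn : 𝓕.NonnegOn)
    (hW : 𝓕.WindowBound win δ K)
    (H : ∀ ε : ℝ, 0 < ε → ∃ X₀ : ℝ, ∀ X : ℝ, X₀ ≤ X →
      ∀ (D : ℕ) [NeZero D] (χ : DirichletCharacter ℂ D), χ.IsPrimitive → MulChar.IsQuadratic χ →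
        (D : ℝ) ≤ X ^ δ → 0 < 𝓕.avgEvenMass (win X D χ) →
        ∃ M : (P : 𝓕.Param) → 𝓕.Form P → ℝ,
          0 < 𝓕.avgMollFirst (win X D χ) M ∧
          (r - ε) * 𝓕.avgEvenMass (win X D χ) * 𝓕.avgMollSecond (win X D χ) M ≤
            𝓕.avgMollFirst (win X D χ) M ^ 2 ∧
          ((Real.log X) ^ a)⁻¹ ^ 2 * 𝓕.avgEvenMass (win X D χ) * 𝓕.avgMollNorm (win X D χ) M ≤
            ε ^ 2 * 𝓕.avgMollFirst (win X D χ) M ^ 2)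
    {p : ℝ} (hp : p < r) : 𝓕.EStarFamLevelAvg win p a δ := by
  by_cases hp0 : p ≤ 0
  · refine ⟨0, fun X _ D _ χ _ _ _ => ?_⟩
    have h1 := avgEvenMass_nonneg' hnn (win X D χ)
    have h2 := avgGoodMass_nonneg' hnn a (win X D χ)
    nlinarith
  push Not at hp0
  have hr : 0 < r := hp0.trans hp
  set ε : ℝ := min (1 / 2) ((r - p) / (1 + 2 * r)) with hεdef
  have hε : 0 < ε := lt_min (by norm_num) (div_pos (by linarith) (by linarith))
  have hε2 : ε ≤ 1 / 2 := min_le_left _ _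
  have hεr : ε ≤ (r - p) / (1 + 2 * r) := min_le_right _ _
  have hεr' : ε * (1 + 2 * r) ≤ r - p := by rwa [le_div_iff₀ (by linarith)] at hεr
  obtain ⟨X₀, hX₀⟩ := H ε hε
  obtain ⟨X₁, hX₁⟩ := hW
  refine ⟨max (max X₀ X₁) 2, fun X hX D _ χ hprim hquad hD => ?_⟩
  have hXX₀ : X₀ ≤ X := le_trans (le_trans (le_max_left _ _) (le_max_left _ _)) hX
  have hXX₁ : X₁ ≤ X := le_trans (le_trans (le_max_right _ _) (le_max_left _ _)) hX
  have hX2 : (2 : ℝ) ≤ X := le_trans (le_max_right _ _) hX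
  have hb := hX₁ X hXX₁ D χ hprim hquad hD
  set Wn := win X D χ with hWndef
  have hWm : 0 ≤ 𝓕.avgEvenMass Wn := avgEvenMass_nonneg' hnn Wn
  have hG : 0 ≤ 𝓕.avgGoodMass a Wn := avgGoodMass_nonneg' hnn a Wn
  rcases hWm.eq_or_lt with hW0 | hWpos
  · rw [← hW0, mul_zero]; exact hG
  obtain ⟨M, hA1, hCS, hfl⟩ := hX₀ X hXX₀ D χ hprim hquad hD hWpos
  set η : ℝ := ((Real.log X) ^ a)⁻¹ with hηdef
  have hη : 0 ≤ η := inv_nonneg.mpr (pow_nonneg (Real.log_nonneg (by linarith)) _)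
  have hfloor : ∀ P ∈ Wn, 𝓕.floor a P ≤ η := fun P hP => floor_le_of_le_size hX2 (hb P hP).2.1
  exact ratio_step hp0 hp hε2 hε hεr' hWm (avgMollSecond_nonneg hnn Wn M) hη hA1 hCS hfl
    (avgMollFirst_sq_le hnn Wn M) (fun hA => avgGoodMass_ge_of_mollified hnn Wn M hη hfloor hA)

end LevelAverage

/-! ## Transport along `refine` -/

section Refine

variable {A : 𝓕.Param → Prop} {B : ℕ → Prop}

/-- Refinement does not change the mollified first moment. [cite: IwaniecConversations2006, §7 (7.5)] -/
@[simp] theorem refine_mollFirst (P : 𝓕.Param) (M : 𝓕.Form P → ℝ) :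
    (𝓕.refine A B).mollFirst P M = 𝓕.mollFirst P M := rfl

/-- Refinement does not change the mollified second moment. [cite: IwaniecConversations2006, §7 (7.5)] -/
@[simp] theorem refine_mollSecond (P : 𝓕.Param) (M : 𝓕.Form P → ℝ) :
    (𝓕.refine A B).mollSecond P M = 𝓕.mollSecond P M := rfl

/-- Refinement does not change the second moment of the mollifier. [cite: IwaniecConversations2006, §7 (7.5)] -/
@[simp] theorem refine_mollNorm (P : 𝓕.Param) (M : 𝓕.Form P → ℝ) :
    (𝓕.refine A B).mollNorm P M = 𝓕.mollNorm P M := rfl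

/-- Refinement does not change the floor. [cite: IwaniecConversations2006, §7 (7.5)] -/
@[simp] theorem refine_floor (a : ℕ) (P : 𝓕.Param) : (𝓕.refine A B).floor a P = 𝓕.floor a P := rfl

end Refine

end CentralValueFamily

/-! ## The record vocabulary: `𝓗_k(N)` and its prime-level weight-2 refinement -/

section IwaniecSarnakVocabulary

variable {k : ℤ}

/-- At an even weight, the odd newforms (`w_f = −1`) have `L(½,f) = 0`, so a harmonic sum of
`M(f)·L(½,f)`-type statistics over ALL newforms is the sum over the even ones.
[cite: IwaniecConversations2006, §4 (4.5) («the odd members have `L(½,f) = 0` trivially»)] -/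
theorem harmonicSum_eq_harmonicSum_even_of_centralValue {N : ℕ} [NeZero N] (hkev : Even k)
    (g : CuspForm (Gamma0 N) k → ℝ → ℝ) (hg : ∀ f, g f 0 = 0) :
    harmonicSum N k (fun f => g f (centralValue f).re) =
      harmonicSum N k (fun f => if rootNumber f = 1 then g f (centralValue f).re else 0) := by
  rw [harmonicSum_eq_sum (finite_newforms0_holds N k), harmonicSum_eq_sum (finite_newforms0_holds N k)]
  refine Finset.sum_congr rfl fun f hf => ?_
  have hf' : f ∈ newforms0 N k := (Set.Finite.mem_toFinset _).mp hf
  by_cases h : rootNumber f = 1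
  · rw [if_pos h]
  · rw [if_neg h]
    have hw : rootNumber f = -1 := (rootNumber_eq_one_or_neg_one hkev hf').resolve_left h
    rw [centralValue_eq_zero_of_rootNumber hf' hw, Complex.zero_re, hg, mul_zero]

/-- `mollFirst` of the datum `𝓗_k(N)` is the harmonic sum `Σʰ ω_f M(f) L(½,f)` over ALL newforms
(even weight: the odd ones contribute `0`). [cite: IwaniecConversations2006, §7 (7.5)] -/
theorem mollFirst_iwaniecSarnakFamily (hkev : Even k) (N : ℕ+) (M : CuspForm (Gamma0 (N : ℕ)) k → ℝ) :
    (iwaniecSarnakFamily k).mollFirst N M =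
      harmonicSum (N : ℕ) k (fun f => M f * (centralValue f).re) := by
  classical
  rw [harmonicSum_eq_harmonicSum_even_of_centralValue hkev (fun f x => M f * x) (fun f => mul_zero _),
    harmonicSum_eq_sum (finite_newforms0_holds (N : ℕ) k)]
  unfold CentralValueFamily.mollFirst CentralValueFamily.evenForms
  rw [Finset.sum_filter]
  refine Finset.sum_congr rfl fun f _ => ?_
  by_cases h : rootNumber f = 1
  · have h' : (iwaniecSarnakFamily k).Even N f := h
    rw [if_pos h', if_pos h]
    show harmonicWeight f * M f * (centralValue f).re = harmonicWeight f * (M f * (centralValue f).re)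
    ring
  · have h' : ¬ (iwaniecSarnakFamily k).Even N f := h
    rw [if_neg h', if_neg h, mul_zero]

/-- `mollSecond` of the datum `𝓗_k(N)` is the harmonic sum `Σʰ ω_f M(f)² L(½,f)²` over ALL newforms
(even weight). [cite: IwaniecConversations2006, §7 (7.5)] -/
theorem mollSecond_iwaniecSarnakFamily (hkev : Even k) (N : ℕ+) (M : CuspForm (Gamma0 (N : ℕ)) k → ℝ) :
    (iwaniecSarnakFamily k).mollSecond N M =
      harmonicSum (N : ℕ) k (fun f => M f ^ 2 * (centralValue f).re ^ 2) := by
  classical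
  rw [harmonicSum_eq_harmonicSum_even_of_centralValue hkev (fun f x => M f ^ 2 * x ^ 2)
      (fun f => by simp),
    harmonicSum_eq_sum (finite_newforms0_holds (N : ℕ) k)]
  unfold CentralValueFamily.mollSecond CentralValueFamily.evenForms
  rw [Finset.sum_filter]
  refine Finset.sum_congr rfl fun f _ => ?_
  by_cases h : rootNumber f = 1
  · have h' : (iwaniecSarnakFamily k).Even N f := h
    rw [if_pos h', if_pos h]
    show harmonicWeight f * M f ^ 2 * (centralValue f).re ^ 2 =
      harmonicWeight f * (M f ^ 2 * (centralValue f).re ^ 2)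
    ring
  · have h' : ¬ (iwaniecSarnakFamily k).Even N f := h
    rw [if_neg h', if_neg h, mul_zero]

/-- `mollNorm` of the datum `𝓗_k(N)` (the even members only) is at most the harmonic sum `Σʰ ω_f M(f)²`
over ALL newforms (`k ≥ 2`: weights `≥ 0`). [cite: IwaniecConversations2006, §7 (7.3)] -/
theorem mollNorm_iwaniecSarnakFamily_le (hk : 2 ≤ k) (N : ℕ+) (M : CuspForm (Gamma0 (N : ℕ)) k → ℝ) :
    (iwaniecSarnakFamily k).mollNorm N M ≤ harmonicSum (N : ℕ) k (fun f => M f ^ 2) := by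
  classical
  rw [harmonicSum_eq_sum (finite_newforms0_holds (N : ℕ) k)]
  unfold CentralValueFamily.mollNorm CentralValueFamily.evenForms
  exact Finset.sum_le_sum_of_subset_of_nonneg (Finset.filter_subset _ _)
    (fun f _ _ => mul_nonneg (harmonicWeight_nonneg hk f) (sq_nonneg _))

/-- The square of the floor `(log N)⁻²` of `𝓗_k(N)` is `(log N)⁻⁴`. [cite: IwaniecConversations2006, §7 (7.5)] -/
theorem floor_two_sq_iwaniecSarnakFamily (N : ℕ+) :
    (iwaniecSarnakFamily k).floor 2 N ^ 2 = (Real.log (N : ℕ))⁻¹ ^ 4 := by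
  show (((Real.log ((N : ℕ) : ℝ)) ^ 2)⁻¹) ^ 2 = _
  rw [← inv_pow, ← pow_mul]

/-- **MOLLIFIED HARMONIC MOMENTS ⇒ `UntwistedProportion k r`** (`𝓗_k(N)`, even `k ≥ 2`, squarefree
levels; the (P)-row target of the fam edge is `r = ½ + η`). Assume the non-negativity fact
(Lapid–Rallis/Guo) and that for every `ε > 0`, for all large squarefree `N` with positive even harmonic
mass `W = Σʰ_{w_f=1} ω_f`, there are real mollifier values `M` on `S_k(Γ₀(N))` with
`A₁ = Σʰ ω M L(½,f) > 0`, `(r − ε)·W·Σʰ ω M² L(½,f)² ≤ A₁²` and `(log N)⁻⁴·W·Σʰ ω M² ≤ ε²·A₁²`. Then for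
every `ε > 0` and all large squarefree `N` a harmonic proportion `≥ r − ε` of the even newforms has
`L(½,f) ≥ (log N)⁻²`. Nothing here asserts the hypotheses for any `M`.
[cite: IwaniecSarnak2000, Thm. 1 (method)] [cite: BalkanovaFrolenkov2021, §8.4 proof of Theorem 8.7] -/
theorem untwistedProportion_of_mollifiedMoments (hk : 2 ≤ k) (hkev : Even k)
    (hLR : lapidRallis2003_theorem1_gl2Twist) {r : ℝ}
    (H : ∀ ε : ℝ, 0 < ε → ∃ N₀ : ℕ, ∀ (N : ℕ) [NeZero N], N₀ ≤ N → Squarefree N →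
      0 < harmonicSum N k (fun f => if rootNumber f = 1 then (1 : ℝ) else 0) →
      ∃ M : CuspForm (Gamma0 N) k → ℝ,
        0 < harmonicSum N k (fun f => M f * (centralValue f).re) ∧
        (r - ε) * harmonicSum N k (fun f => if rootNumber f = 1 then (1 : ℝ) else 0) *
            harmonicSum N k (fun f => M f ^ 2 * (centralValue f).re ^ 2) ≤
          harmonicSum N k (fun f => M f * (centralValue f).re) ^ 2 ∧
        (Real.log N)⁻¹ ^ 4 * harmonicSum N k (fun f => if rootNumber f = 1 then (1 : ℝ) else 0) *
            harmonicSum N k (fun f => M f ^ 2) ≤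
          ε ^ 2 * harmonicSum N k (fun f => M f * (centralValue f).re) ^ 2) :
    UntwistedProportion k r := by
  intro eps heps
  have hE : (iwaniecSarnakFamily k).EStarFam (r - eps) 2 := by
    refine CentralValueFamily.EStarFam_of_mollifiedMoments (a := 2) (r := r) (p := r - eps)
      (iwaniecSarnakFamily_nonnegOn hk hLR) (fun ε hε => ?_) (by linarith)
    obtain ⟨N₀, hN₀⟩ := H ε hε
    refine ⟨(N₀ : ℝ), fun (N : ℕ+) (hsq : Squarefree (N : ℕ)) (hN : (N₀ : ℝ) ≤ ((N : ℕ) : ℝ))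
      hW => ?_⟩
    have hN' : N₀ ≤ (N : ℕ) := by exact_mod_cast hN
    rw [evenMass_iwaniecSarnakFamily] at hW
    obtain ⟨M, h1, h2, h3⟩ := hN₀ (N : ℕ) hN' hsq hW
    refine ⟨M, ?_, ?_, ?_⟩
    · rwa [mollFirst_iwaniecSarnakFamily hkev]
    · rwa [mollFirst_iwaniecSarnakFamily hkev, mollSecond_iwaniecSarnakFamily hkev,
        evenMass_iwaniecSarnakFamily]
    · rw [mollFirst_iwaniecSarnakFamily hkev, evenMass_iwaniecSarnakFamily,
        floor_two_sq_iwaniecSarnakFamily]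
      refine le_trans ?_ h3
      refine mul_le_mul_of_nonneg_left (mollNorm_iwaniecSarnakFamily_le hk N M) ?_
      exact mul_nonneg (pow_nonneg (inv_nonneg.mpr (Real.log_natCast_nonneg _)) _) hW.le
  obtain ⟨s₀, hs₀⟩ := hE
  refine ⟨⌈s₀⌉₊, fun N _ hN hsq => ?_⟩
  have hNpos : 0 < N := Nat.pos_of_ne_zero (NeZero.ne N)
  have hs : s₀ ≤ ((N : ℕ) : ℝ) := le_trans (Nat.le_ceil s₀) (by exact_mod_cast hN)
  have h := hs₀ ⟨N, hNpos⟩ hsq hs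
  rw [evenMass_iwaniecSarnakFamily, goodMass_iwaniecSarnakFamily] at h
  exact h

/-- **MOLLIFIED HARMONIC MOMENTS AT PRIME LEVEL, WEIGHT 2 ⇒ THE PRIME-LEVEL EDGE SOCKET**: the same three
scale-free conditions, asked at PRIME levels `q → ∞` only, with a Cauchy–Schwarz value `r > ½`, give
`∃ p₁ > ½, primeLevelFamilyTwo.EStarFam p₁ 2` — the edge hypothesis of the weight-2 decision displays
`lOne_lowerBound_of_EStarFam_prime_weightTwo` / `…'` (`p₁ = (½ + r)/2`). Nothing here asserts the
hypotheses for any `M`. [cite: IwaniecSarnak2000, Thm. 1 (method)] [cite: BalkanovaFrolenkov2021, §8.4 proof of Theorem 8.7] -/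
theorem primeLevelFamilyTwo_EStarFam_of_mollifiedMoments (hLR : lapidRallis2003_theorem1_gl2Twist)
    {r : ℝ} (hr : 1 / 2 < r)
    (H : ∀ ε : ℝ, 0 < ε → ∃ N₀ : ℕ, ∀ (N : ℕ) [NeZero N], N₀ ≤ N → N.Prime →
      0 < harmonicSum N 2 (fun f => if rootNumber f = 1 then (1 : ℝ) else 0) →
      ∃ M : CuspForm (Gamma0 N) 2 → ℝ,
        0 < harmonicSum N 2 (fun f => M f * (centralValue f).re) ∧
        (r - ε) * harmonicSum N 2 (fun f => if rootNumber f = 1 then (1 : ℝ) else 0) *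
            harmonicSum N 2 (fun f => M f ^ 2 * (centralValue f).re ^ 2) ≤
          harmonicSum N 2 (fun f => M f * (centralValue f).re) ^ 2 ∧
        (Real.log N)⁻¹ ^ 4 * harmonicSum N 2 (fun f => if rootNumber f = 1 then (1 : ℝ) else 0) *
            harmonicSum N 2 (fun f => M f ^ 2) ≤
          ε ^ 2 * harmonicSum N 2 (fun f => M f * (centralValue f).re) ^ 2) :
    ∃ p₁ : ℝ, 1 / 2 < p₁ ∧ primeLevelFamilyTwo.EStarFam p₁ 2 := by
  refine ⟨(1 / 2 + r) / 2, by linarith, ?_⟩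
  have hkev : Even (2 : ℤ) := ⟨1, rfl⟩
  refine CentralValueFamily.EStarFam_of_mollifiedMoments (a := 2) (r := r) (p := (1 / 2 + r) / 2)
    (primeLevelFamilyTwo_nonnegOn hLR) (fun ε hε => ?_) (by linarith)
  obtain ⟨N₀, hN₀⟩ := H ε hε
  refine ⟨(N₀ : ℝ), fun (N : ℕ+) hadm (hN : (N₀ : ℝ) ≤ ((N : ℕ) : ℝ)) hW => ?_⟩
  have hprime : (N : ℕ).Prime := hadm.2
  have hN' : N₀ ≤ (N : ℕ) := by exact_mod_cast hN
  rw [CentralValueFamily.refine_evenMass, evenMass_iwaniecSarnakFamily] at hW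
  obtain ⟨M, h1, h2, h3⟩ := hN₀ (N : ℕ) hN' hprime hW
  refine ⟨M, ?_, ?_, ?_⟩
  · rwa [CentralValueFamily.refine_mollFirst, mollFirst_iwaniecSarnakFamily hkev]
  · rwa [CentralValueFamily.refine_mollFirst, CentralValueFamily.refine_mollSecond,
      CentralValueFamily.refine_evenMass, mollFirst_iwaniecSarnakFamily hkev,
      mollSecond_iwaniecSarnakFamily hkev, evenMass_iwaniecSarnakFamily]
  · rw [CentralValueFamily.refine_mollFirst, CentralValueFamily.refine_mollNorm,
      CentralValueFamily.refine_evenMass, CentralValueFamily.refine_floor,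
      mollFirst_iwaniecSarnakFamily hkev, evenMass_iwaniecSarnakFamily, floor_two_sq_iwaniecSarnakFamily]
    refine le_trans ?_ h3
    refine mul_le_mul_of_nonneg_left (mollNorm_iwaniecSarnakFamily_le (by norm_num) N M) ?_
    exact mul_nonneg (pow_nonneg (inv_nonneg.mpr (Real.log_natCast_nonneg _)) _) hW.le

/-! ### The total-mass normalisation (Kowalski–Michel–VanderKam: «a quarter of all forms») -/

/-- **MOLLIFIED HARMONIC MOMENTS AT PRIME LEVEL, WEIGHT 2, TOTAL-MASS NORMALISATION ⇒ THE PRIME-LEVEL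
EDGE SOCKET.** Assume the non-negativity fact, Kowalski–Michel's Petersson fact, and that for every
`ε > 0`, for all large primes `q`, there are real mollifier values `M` on `S₂(Γ₀(q))` with
`A₁ = Σʰ ω M L(½,f) > 0`, Cauchy–Schwarz value against the TOTAL harmonic mass `T = Σʰ ω` at least
`v − ε` (`(v − ε)·T·Σʰ ω M² L(½,f)² ≤ A₁²`) and `(log q)⁻⁴·T·Σʰ ω M² ≤ ε²·A₁²`. If `v > ¼` then
`∃ p₁ > ½, primeLevelFamilyTwo.EStarFam p₁ 2`. The even harmonic mass is `≤ (½ + o(1))·T` by the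
Petersson fact at `(m,n) = (q,1), (1,1)` (`abs_two_mul_evenMass_sub_totalMass_le`,
`abs_totalMass_sub_one_le`), which converts «`> ¼` of all» into «`> ½` of the even» (`r = v + ¼`).
Nothing here asserts the hypotheses for any `M`.
[cite: KowalskiMichelVanderKam2000, §1 (2) and Thm. 1.1 («p₀ ≥ ¼» of all forms)] [cite: BalkanovaFrolenkov2021, §8.4 proof of Theorem 8.7] -/
theorem primeLevelFamilyTwo_EStarFam_of_mollifiedMoments_total
    (hLR : lapidRallis2003_theorem1_gl2Twist) (hP : KowalskiMichel2000.kowalskiMichel2000_petersson)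
    {v : ℝ} (hv : 1 / 4 < v)
    (H : ∀ ε : ℝ, 0 < ε → ∃ N₀ : ℕ, ∀ (N : ℕ) [NeZero N], N₀ ≤ N → N.Prime →
      ∃ M : CuspForm (Gamma0 N) 2 → ℝ,
        0 < harmonicSum N 2 (fun f => M f * (centralValue f).re) ∧
        (v - ε) * harmonicSum N 2 (fun _ => (1 : ℝ)) *
            harmonicSum N 2 (fun f => M f ^ 2 * (centralValue f).re ^ 2) ≤
          harmonicSum N 2 (fun f => M f * (centralValue f).re) ^ 2 ∧
        (Real.log N)⁻¹ ^ 4 * harmonicSum N 2 (fun _ => (1 : ℝ)) *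
            harmonicSum N 2 (fun f => M f ^ 2) ≤
          ε ^ 2 * harmonicSum N 2 (fun f => M f * (centralValue f).re) ^ 2) :
    ∃ p₁ : ℝ, 1 / 2 < p₁ ∧ primeLevelFamilyTwo.EStarFam p₁ 2 := by
  obtain ⟨C₁, hT⟩ := abs_totalMass_sub_one_le hP
  obtain ⟨C₂, hE⟩ := abs_two_mul_evenMass_sub_totalMass_le hP
  have hk : (2 : ℤ) ≤ 2 := le_rfl
  -- the even-mass ratio `r = v + ¼ > ½` (strictly between `½` and `2v`)
  set r : ℝ := v + 1 / 4 with hrdef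
  have hr : 1 / 2 < r := by rw [hrdef]; linarith
  have hrpos : 0 < r := by linarith
  refine primeLevelFamilyTwo_EStarFam_of_mollifiedMoments hLR hr (fun ε hε => ?_)
  -- slacks: `ε' = (4v − 1)/16` on the KMV side, `δ' = ε'/r` on the even share
  set ε' : ℝ := (4 * v - 1) / 16 with hε'def
  have hε' : 0 < ε' := by rw [hε'def]; linarith
  set δ' : ℝ := ε' / r with hδ'def
  have hδ' : 0 < δ' := div_pos hε' hrpos
  have hrδ' : r * δ' = ε' := by rw [hδ'def]; field_simp
  obtain ⟨N₀, hN₀⟩ := H (min ε' ε) (lt_min hε' hε)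
  set Mc : ℝ := max C₂ 0 with hMcdef
  have hMc : 0 ≤ Mc := le_max_right _ _
  refine ⟨max N₀ (max ⌈8 * C₁⌉₊ ⌈(Mc / δ') ^ 4⌉₊), fun N _ hN hprime _ => ?_⟩
  have hN₀le : N₀ ≤ N := le_trans (le_max_left _ _) hN
  have h8 : 8 * C₁ ≤ (N : ℝ) :=
    le_trans (Nat.le_ceil _) (by exact_mod_cast le_trans (le_trans (le_max_left _ _) (le_max_right _ _)) hN)
  have h4 : (Mc / δ') ^ 4 ≤ (N : ℝ) :=
    le_trans (Nat.le_ceil _) (by exact_mod_cast le_trans (le_trans (le_max_right _ _) (le_max_right _ _)) hN)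
  have hq1 : (1 : ℝ) ≤ N := by exact_mod_cast hprime.one_lt.le
  have hqpos : (0 : ℝ) < N := lt_of_lt_of_le one_pos hq1
  obtain ⟨M, h1, h2, h3⟩ := hN₀ N hN₀le hprime
  -- abbreviations
  set T : ℝ := harmonicSum N 2 (fun _ => (1 : ℝ)) with hTdef
  set E : ℝ := harmonicSum N 2 (fun f => if rootNumber f = 1 then (1 : ℝ) else 0) with hEdef
  set A₁ : ℝ := harmonicSum N 2 (fun f => M f * (centralValue f).re) with hA₁def
  set A₂ : ℝ := harmonicSum N 2 (fun f => M f ^ 2 * (centralValue f).re ^ 2) with hA₂def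
  set Nn : ℝ := harmonicSum N 2 (fun f => M f ^ 2) with hNndef
  have hEnn : 0 ≤ E := harmonicSum_nonneg hk fun f => by positivity
  have hA₂nn : 0 ≤ A₂ := harmonicSum_nonneg hk fun f => by positivity
  have hNn : 0 ≤ Nn := harmonicSum_nonneg hk fun f => by positivity
  have hET : E ≤ T :=
    harmonicSum_mono hk (finite_newforms0_holds N 2) fun f _ => by split_ifs <;> norm_num
  -- the total-mass error is `≤ 1/8`, so `T ≥ 7/8`
  have ha : C₁ * (N : ℝ) ^ (-(3 / 2 : ℝ)) ≤ 1 / 8 := by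
    have hrpow : (N : ℝ) ^ (-(3 / 2 : ℝ)) ≤ (N : ℝ)⁻¹ := by
      rw [← Real.rpow_neg_one]
      exact Real.rpow_le_rpow_of_exponent_le hq1 (by norm_num)
    have hrp : 0 ≤ (N : ℝ) ^ (-(3 / 2 : ℝ)) := Real.rpow_nonneg hqpos.le _
    rcases le_or_gt 0 C₁ with hc | hc
    · calc C₁ * (N : ℝ) ^ (-(3 / 2 : ℝ)) ≤ C₁ * (N : ℝ)⁻¹ := mul_le_mul_of_nonneg_left hrpow hc
        _ ≤ 1 / 8 := by rw [← div_eq_mul_inv, div_le_iff₀ hqpos]; linarith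
    · linarith [mul_nonpos_of_nonpos_of_nonneg hc.le hrp]
  have hT' := abs_le.mp (le_trans (hT N hprime) ha)
  have hT78 : 7 / 8 ≤ T := by rw [hTdef]; linarith [hT'.1]
  -- the root-number-sum error is `≤ δ'`, so `E ≤ (½ + δ')·T`
  have hb : C₂ * (N : ℝ) ^ (-(1 / 4 : ℝ)) ≤ δ' := by
    have hrp : 0 ≤ (N : ℝ) ^ (-(1 / 4 : ℝ)) := Real.rpow_nonneg hqpos.le _
    have h4' : (0 : ℝ) ≤ (Mc / δ') ^ 4 := by positivity
    have hmono := Real.rpow_le_rpow h4' h4 (by norm_num : (0 : ℝ) ≤ 1 / 4)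
    have e : ((Mc / δ') ^ 4) ^ (1 / 4 : ℝ) = Mc / δ' := by
      rw [show (1 / 4 : ℝ) = ((4 : ℕ) : ℝ)⁻¹ by norm_num]
      exact Real.pow_rpow_inv_natCast (by positivity) (by norm_num)
    rw [e] at hmono
    have hqr : 0 < (N : ℝ) ^ (1 / 4 : ℝ) := Real.rpow_pos_of_pos hqpos _
    calc C₂ * (N : ℝ) ^ (-(1 / 4 : ℝ)) ≤ Mc * (N : ℝ) ^ (-(1 / 4 : ℝ)) :=
          mul_le_mul_of_nonneg_right (le_max_left _ _) hrp
      _ = Mc * ((N : ℝ) ^ (1 / 4 : ℝ))⁻¹ := by rw [Real.rpow_neg hqpos.le]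
      _ ≤ δ' := by
          rw [mul_inv_le_iff₀ hqr]
          calc Mc = Mc / δ' * δ' := by field_simp
            _ ≤ (N : ℝ) ^ (1 / 4 : ℝ) * δ' := mul_le_mul_of_nonneg_right hmono hδ'.le
            _ = δ' * (N : ℝ) ^ (1 / 4 : ℝ) := mul_comm _ _
  have hE' := abs_le.mp (le_trans (hE N hprime) hb)
  have hEle : E ≤ (1 / 2 + δ') * T := by
    have : 2 * E ≤ T + δ' := by rw [hEdef, hTdef]; linarith [hE'.2]
    nlinarith
  refine ⟨M, h1, ?_, ?_⟩
  · -- the Cauchy–Schwarz value against the EVEN mass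
    have hTA : 0 ≤ T * A₂ := mul_nonneg (by linarith) hA₂nn
    have hmin : (v - ε') * T * A₂ ≤ A₁ ^ 2 := by
      refine le_trans ?_ h2
      have : (v - ε') * T * A₂ ≤ (v - min ε' ε) * T * A₂ := by
        rw [mul_assoc, mul_assoc]
        exact mul_le_mul_of_nonneg_right (by linarith [min_le_left ε' ε]) hTA
      exact this
    rcases le_or_gt (r - ε) 0 with hneg | hposre
    · calc (r - ε) * E * A₂ = (r - ε) * (E * A₂) := by ring
        _ ≤ 0 := mul_nonpos_of_nonpos_of_nonneg hneg (mul_nonneg hEnn hA₂nn)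
        _ ≤ A₁ ^ 2 := sq_nonneg _
    · calc (r - ε) * E * A₂ ≤ (r - ε) * ((1 / 2 + δ') * T) * A₂ :=
            mul_le_mul_of_nonneg_right (mul_le_mul_of_nonneg_left hEle hposre.le) hA₂nn
        _ = (r - ε) * ((1 / 2 + δ') * (T * A₂)) := by ring
        _ ≤ r * ((1 / 2 + δ') * (T * A₂)) :=
            mul_le_mul_of_nonneg_right (by linarith) (mul_nonneg (by linarith) hTA)
        _ = (r / 2 + r * δ') * T * A₂ := by ring
        _ = (v - ε') * T * A₂ := by rw [hrδ', hrdef, hε'def]; ring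
        _ ≤ A₁ ^ 2 := hmin
  · -- the floor against the EVEN mass
    have hlog : 0 ≤ (Real.log N)⁻¹ ^ 4 := pow_nonneg (inv_nonneg.mpr (Real.log_natCast_nonneg _)) _
    calc (Real.log N)⁻¹ ^ 4 * E * Nn ≤ (Real.log N)⁻¹ ^ 4 * T * Nn :=
          mul_le_mul_of_nonneg_right (mul_le_mul_of_nonneg_left hET hlog) hNn
      _ ≤ (min ε' ε) ^ 2 * A₁ ^ 2 := h3
      _ ≤ ε ^ 2 * A₁ ^ 2 :=
          mul_le_mul_of_nonneg_right
            (pow_le_pow_left₀ (le_min hε'.le hε.le) (min_le_right _ _) 2) (sq_nonneg _)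

/-! ### The summit vocabulary -/

/-- **Mollified harmonic moments beyond a quarter + the four printed facts ⇒ `LOneLowerBound 4`**
(`L(1,χ) > c₁(log D)⁻⁴` for every real primitive `χ` mod `D ≥ 3`): the total-mass moment hypotheses
at prime level, weight `2`, with `v > ¼`, give the prime-level edge
(`primeLevelFamilyTwo_EStarFam_of_mollifiedMoments_total`); the weight-2 decision display with four
printed facts (`lOne_lowerBound_of_EStarFam_prime_weightTwo'`) and the eventual→skeleton bridge
(`lOneLowerBound_of_eventual`) conclude. Every fact is a displayed hypothesis; none is asserted.
[cite: IwaniecConversations2006, §7 (7.7) and p. 97] [cite: Zhang2022LandauSiegel, §1 Theorem 1 (shape `LOneLowerBound`)] -/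
theorem lOneLowerBound_four_of_mollifiedMoments_prime_weightTwo
    (hLR : lapidRallis2003_theorem1_gl2Twist) (hTw : iwaniec2006_twistedHalf)
    (hMix : iwaniec2006_mixedMomentOverMass) (hP : KowalskiMichel2000.kowalskiMichel2000_petersson)
    {v : ℝ} (hv : 1 / 4 < v)
    (H : ∀ ε : ℝ, 0 < ε → ∃ N₀ : ℕ, ∀ (N : ℕ) [NeZero N], N₀ ≤ N → N.Prime →
      ∃ M : CuspForm (Gamma0 N) 2 → ℝ,
        0 < harmonicSum N 2 (fun f => M f * (centralValue f).re) ∧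
        (v - ε) * harmonicSum N 2 (fun _ => (1 : ℝ)) *
            harmonicSum N 2 (fun f => M f ^ 2 * (centralValue f).re ^ 2) ≤
          harmonicSum N 2 (fun f => M f * (centralValue f).re) ^ 2 ∧
        (Real.log N)⁻¹ ^ 4 * harmonicSum N 2 (fun _ => (1 : ℝ)) *
            harmonicSum N 2 (fun f => M f ^ 2) ≤
          ε ^ 2 * harmonicSum N 2 (fun f => M f * (centralValue f).re) ^ 2) :
    Zhang2022.Skeleton.LOneLowerBound 4 := by
  obtain ⟨p₁, hp₁, hEdge⟩ := primeLevelFamilyTwo_EStarFam_of_mollifiedMoments_total hLR hP hv H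
  refine lOneLowerBound_of_eventual ?_
  obtain ⟨c, hc, D₀, h⟩ := lOne_lowerBound_of_EStarFam_prime_weightTwo' hLR hTw hMix hP hp₁ hEdge
  exact ⟨c, hc, D₀, fun D _ χ hD hprim hquad => h D χ hD hprim hquad⟩

/-- **… and hence `Zhang2022.Skeleton.Theorem1`** (`= LOneLowerBound 2022`, by
`Section1.lOneLowerBound_mono`, `4 ≤ 2022`): the mollified-moment hypotheses beyond a quarter at prime
level, weight `2`, plus the four printed facts, conclude the Landau–Siegel rung's leaf of record. A
CONDITIONAL display: the moment hypotheses are OPEN IN PRINT beyond the diagonal (KMV2000 prove them for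
`Δ < 1`, where `v < ¼`). [cite: Zhang2022LandauSiegel, §1 Theorem 1] [cite: IwaniecConversations2006, §7 (7.7)] -/
theorem theorem1_of_mollifiedMoments_prime_weightTwo
    (hLR : lapidRallis2003_theorem1_gl2Twist) (hTw : iwaniec2006_twistedHalf)
    (hMix : iwaniec2006_mixedMomentOverMass) (hP : KowalskiMichel2000.kowalskiMichel2000_petersson)
    {v : ℝ} (hv : 1 / 4 < v)
    (H : ∀ ε : ℝ, 0 < ε → ∃ N₀ : ℕ, ∀ (N : ℕ) [NeZero N], N₀ ≤ N → N.Prime →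
      ∃ M : CuspForm (Gamma0 N) 2 → ℝ,
        0 < harmonicSum N 2 (fun f => M f * (centralValue f).re) ∧
        (v - ε) * harmonicSum N 2 (fun _ => (1 : ℝ)) *
            harmonicSum N 2 (fun f => M f ^ 2 * (centralValue f).re ^ 2) ≤
          harmonicSum N 2 (fun f => M f * (centralValue f).re) ^ 2 ∧
        (Real.log N)⁻¹ ^ 4 * harmonicSum N 2 (fun _ => (1 : ℝ)) *
            harmonicSum N 2 (fun f => M f ^ 2) ≤
          ε ^ 2 * harmonicSum N 2 (fun f => M f * (centralValue f).re) ^ 2) :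
    Zhang2022.Skeleton.Theorem1 :=
  Zhang2022.Section1.lOneLowerBound_mono (by norm_num)
    (lOneLowerBound_four_of_mollifiedMoments_prime_weightTwo hLR hTw hMix hP hv H)

/-! ### Level classes and windows: `iwaniecSarnakFamilyOn k A` -/

section LevelClass

variable {A : ℕ+ → Prop}

/-- Same mollified first moment on a level class. [cite: IwaniecConversations2006, §7 (7.5)] -/
@[simp] theorem mollFirst_iwaniecSarnakFamilyOn (N : ℕ+) (M : CuspForm (Gamma0 (N : ℕ)) k → ℝ) :
    (iwaniecSarnakFamilyOn k A).mollFirst N M = (iwaniecSarnakFamily k).mollFirst N M := rfl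

/-- Same mollified second moment on a level class. [cite: IwaniecConversations2006, §7 (7.5)] -/
@[simp] theorem mollSecond_iwaniecSarnakFamilyOn (N : ℕ+) (M : CuspForm (Gamma0 (N : ℕ)) k → ℝ) :
    (iwaniecSarnakFamilyOn k A).mollSecond N M = (iwaniecSarnakFamily k).mollSecond N M := rfl

/-- Same mollifier second moment on a level class. [cite: IwaniecConversations2006, §7 (7.5)] -/
@[simp] theorem mollNorm_iwaniecSarnakFamilyOn (N : ℕ+) (M : CuspForm (Gamma0 (N : ℕ)) k → ℝ) :
    (iwaniecSarnakFamilyOn k A).mollNorm N M = (iwaniecSarnakFamily k).mollNorm N M := rfl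

/-- **LEVEL-AVERAGED MOLLIFIED HARMONIC MOMENTS ⇒ `EStarFamLevelAvg` ON A LEVEL CLASS** (`𝓗_k(N)`
restricted to an arbitrary class `A` of levels — squarefree = the datum of record, the square tower,
prime powers …; even `k ≥ 2`; any bounded window scheme `win` of admissible levels). In the record
vocabulary: if for every `ε > 0`, for all large `X` and all real primitive `χ_D` with `D ≤ X^δ` whose
window `win X χ` has positive even harmonic mass `W = Σ_{N ∈ win} Σʰ_{w_f=1} ω_f`, there are real
mollifier values `M_N` on `S_k(Γ₀(N))`, `N ∈ win X χ`, with
`A₁ = Σ_N Σʰ ω M_N L(½,f) > 0`, `(r − ε)·W·Σ_N Σʰ ω M_N² L(½,f)² ≤ A₁²` and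
`(log X)⁻⁴·W·Σ_N Σʰ ω M_N² ≤ ε²·A₁²`, then `(iwaniecSarnakFamilyOn k A).EStarFamLevelAvg win p 2 δ`
for every `p < r`: over the window, a harmonic proportion `≥ p` of the even newforms has
`L(½,f) ≥ (log N)⁻²`. Nothing here asserts the hypotheses for any `M`.
[cite: IwaniecSarnak2000, Thm. 1 (method)] [cite: IwaniecConversations2006, §7 (7.5) and p0097:L15] -/
theorem EStarFamLevelAvg_iwaniecSarnakFamilyOn_of_mollifiedMoments (hk : 2 ≤ k) (hkev : Even k)
    (hLR : lapidRallis2003_theorem1_gl2Twist)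
    {win : ℝ → (D : ℕ) → DirichletCharacter ℂ D → Finset ℕ+} {δ K r : ℝ}
    (hW : (iwaniecSarnakFamilyOn k A).WindowBound win δ K)
    (H : ∀ ε : ℝ, 0 < ε → ∃ X₀ : ℝ, ∀ X : ℝ, X₀ ≤ X →
      ∀ (D : ℕ) [NeZero D] (χ : DirichletCharacter ℂ D), χ.IsPrimitive → MulChar.IsQuadratic χ →
        (D : ℝ) ≤ X ^ δ →
        0 < ∑ N ∈ win X D χ, harmonicSum (N : ℕ) k (fun f => if rootNumber f = 1 then (1 : ℝ) else 0) →
        ∃ M : (N : ℕ+) → CuspForm (Gamma0 (N : ℕ)) k → ℝ,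
          0 < ∑ N ∈ win X D χ, harmonicSum (N : ℕ) k (fun f => M N f * (centralValue f).re) ∧
          (r - ε) * (∑ N ∈ win X D χ, harmonicSum (N : ℕ) k (fun f => if rootNumber f = 1 then (1 : ℝ) else 0)) *
              (∑ N ∈ win X D χ, harmonicSum (N : ℕ) k (fun f => M N f ^ 2 * (centralValue f).re ^ 2)) ≤
            (∑ N ∈ win X D χ, harmonicSum (N : ℕ) k (fun f => M N f * (centralValue f).re)) ^ 2 ∧
          (Real.log X)⁻¹ ^ 4 *
              (∑ N ∈ win X D χ, harmonicSum (N : ℕ) k (fun f => if rootNumber f = 1 then (1 : ℝ) else 0)) *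
              (∑ N ∈ win X D χ, harmonicSum (N : ℕ) k (fun f => M N f ^ 2)) ≤
            ε ^ 2 * (∑ N ∈ win X D χ, harmonicSum (N : ℕ) k (fun f => M N f * (centralValue f).re)) ^ 2)
    {p : ℝ} (hp : p < r) : (iwaniecSarnakFamilyOn k A).EStarFamLevelAvg win p 2 δ := by
  have hA1e : ∀ (W : Finset ℕ+) (M : (N : ℕ+) → CuspForm (Gamma0 (N : ℕ)) k → ℝ),
      (iwaniecSarnakFamilyOn k A).avgMollFirst W M =
        ∑ N ∈ W, harmonicSum (N : ℕ) k (fun f => M N f * (centralValue f).re) := fun W M =>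
    Finset.sum_congr rfl fun N _ => by
      rw [mollFirst_iwaniecSarnakFamilyOn, mollFirst_iwaniecSarnakFamily hkev]
  have hA2e : ∀ (W : Finset ℕ+) (M : (N : ℕ+) → CuspForm (Gamma0 (N : ℕ)) k → ℝ),
      (iwaniecSarnakFamilyOn k A).avgMollSecond W M =
        ∑ N ∈ W, harmonicSum (N : ℕ) k (fun f => M N f ^ 2 * (centralValue f).re ^ 2) := fun W M =>
    Finset.sum_congr rfl fun N _ => by
      rw [mollSecond_iwaniecSarnakFamilyOn, mollSecond_iwaniecSarnakFamily hkev]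
  have hWe : ∀ W : Finset ℕ+, (iwaniecSarnakFamilyOn k A).avgEvenMass W =
      ∑ N ∈ W, harmonicSum (N : ℕ) k (fun f => if rootNumber f = 1 then (1 : ℝ) else 0) := fun W =>
    Finset.sum_congr rfl fun N _ => by
      rw [evenMass_iwaniecSarnakFamilyOn, evenMass_iwaniecSarnakFamily]
  have hNle : ∀ (W : Finset ℕ+) (M : (N : ℕ+) → CuspForm (Gamma0 (N : ℕ)) k → ℝ),
      (iwaniecSarnakFamilyOn k A).avgMollNorm W M ≤
        ∑ N ∈ W, harmonicSum (N : ℕ) k (fun f => M N f ^ 2) := fun W M =>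
    Finset.sum_le_sum fun N _ => by
      rw [mollNorm_iwaniecSarnakFamilyOn]; exact mollNorm_iwaniecSarnakFamily_le hk N (M N)
  refine CentralValueFamily.EStarFamLevelAvg_of_mollifiedMomentsAvg (a := 2) (r := r) (p := p)
    (iwaniecSarnakFamilyOn_nonnegOn hk hLR) hW (fun ε hε => ?_) hp
  obtain ⟨X₀, hX₀⟩ := H ε hε
  refine ⟨X₀, fun X hX D _ χ hprim hquad hD hWpos => ?_⟩
  rw [hWe] at hWpos
  obtain ⟨M, h1, h2, h3⟩ := hX₀ X hX D χ hprim hquad hD hWpos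
  refine ⟨M, ?_, ?_, ?_⟩
  · rwa [hA1e]
  · rwa [hA1e, hA2e, hWe]
  · rw [hA1e, hWe]
    have e : ((Real.log X) ^ 2)⁻¹ ^ 2 = (Real.log X)⁻¹ ^ 4 := by rw [← inv_pow, ← pow_mul]
    rw [e]
    refine le_trans ?_ h3
    exact mul_le_mul_of_nonneg_left (hNle _ M) (mul_nonneg (by positivity) hWpos.le)

/-- **The squarefree class = the datum of record `𝓗_k(N)`**: the same conversion stated for
`iwaniecSarnakFamily k` and any bounded window scheme (e.g. the guarded compatible window
`(iwaniecSarnakFamily k).ntWindow compatibleWindow` of the (A)-row target, or the plain window).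
[cite: IwaniecSarnak2000, Thm. 1 (method)] [cite: IwaniecConversations2006, §7 (7.5) and p0097:L15] -/
theorem EStarFamLevelAvg_iwaniecSarnakFamily_of_mollifiedMoments (hk : 2 ≤ k) (hkev : Even k)
    (hLR : lapidRallis2003_theorem1_gl2Twist)
    {win : ℝ → (D : ℕ) → DirichletCharacter ℂ D → Finset ℕ+} {δ K r : ℝ}
    (hW : (iwaniecSarnakFamily k).WindowBound win δ K)
    (H : ∀ ε : ℝ, 0 < ε → ∃ X₀ : ℝ, ∀ X : ℝ, X₀ ≤ X →
      ∀ (D : ℕ) [NeZero D] (χ : DirichletCharacter ℂ D), χ.IsPrimitive → MulChar.IsQuadratic χ →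
        (D : ℝ) ≤ X ^ δ →
        0 < ∑ N ∈ win X D χ, harmonicSum (N : ℕ) k (fun f => if rootNumber f = 1 then (1 : ℝ) else 0) →
        ∃ M : (N : ℕ+) → CuspForm (Gamma0 (N : ℕ)) k → ℝ,
          0 < ∑ N ∈ win X D χ, harmonicSum (N : ℕ) k (fun f => M N f * (centralValue f).re) ∧
          (r - ε) * (∑ N ∈ win X D χ, harmonicSum (N : ℕ) k (fun f => if rootNumber f = 1 then (1 : ℝ) else 0)) *
              (∑ N ∈ win X D χ, harmonicSum (N : ℕ) k (fun f => M N f ^ 2 * (centralValue f).re ^ 2)) ≤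
            (∑ N ∈ win X D χ, harmonicSum (N : ℕ) k (fun f => M N f * (centralValue f).re)) ^ 2 ∧
          (Real.log X)⁻¹ ^ 4 *
              (∑ N ∈ win X D χ, harmonicSum (N : ℕ) k (fun f => if rootNumber f = 1 then (1 : ℝ) else 0)) *
              (∑ N ∈ win X D χ, harmonicSum (N : ℕ) k (fun f => M N f ^ 2)) ≤
            ε ^ 2 * (∑ N ∈ win X D χ, harmonicSum (N : ℕ) k (fun f => M N f * (centralValue f).re)) ^ 2)
    {p : ℝ} (hp : p < r) : (iwaniecSarnakFamily k).EStarFamLevelAvg win p 2 δ := by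
  -- `iwaniecSarnakFamilyOn k Squarefree = iwaniecSarnakFamily k` definitionally
  -- (`iwaniecSarnakFamilyOn_squarefree`)
  exact EStarFamLevelAvg_iwaniecSarnakFamilyOn_of_mollifiedMoments
    (A := fun N => Squarefree (N : ℕ)) hk hkev hLR hW H hp

/-- **The square-tower class (card `fam-nonresidue-square-tower`, its step K1 ⇐ K2):** the same
conversion on the datum `SquareTower.towerFamily k = iwaniecSarnakFamilyOn k IsTowerLevel` over the
guarded tower window `ntWindow towerWindow` (bounded with `K = 2`, `SquareTower.windowBound_towerWindow`):
level-averaged mollified harmonic moments over the tower levels `N = q n² ∈ [X,2X]` with Cauchy–Schwarz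
value `r > ½ + η` give the card's edge `SquareTower.TowerEdge k η δ`. Nothing here asserts the moment
hypothesis. [cite: IwaniecSarnak2000, Thm. 1 (method)] [cite: IwaniecConversations2006, §7 (7.5) and p0097:L15] -/
theorem towerEdge_of_mollifiedMoments (hk : 2 ≤ k) (hkev : Even k)
    (hLR : lapidRallis2003_theorem1_gl2Twist) {δ r : ℝ}
    (H : ∀ ε : ℝ, 0 < ε → ∃ X₀ : ℝ, ∀ X : ℝ, X₀ ≤ X →
      ∀ (D : ℕ) [NeZero D] (χ : DirichletCharacter ℂ D), χ.IsPrimitive → MulChar.IsQuadratic χ →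
        (D : ℝ) ≤ X ^ δ →
        0 < ∑ N ∈ (SquareTower.towerFamily k).ntWindow SquareTower.towerWindow X D χ,
            harmonicSum (N : ℕ) k (fun f => if rootNumber f = 1 then (1 : ℝ) else 0) →
        ∃ M : (N : ℕ+) → CuspForm (Gamma0 (N : ℕ)) k → ℝ,
          0 < ∑ N ∈ (SquareTower.towerFamily k).ntWindow SquareTower.towerWindow X D χ,
              harmonicSum (N : ℕ) k (fun f => M N f * (centralValue f).re) ∧
          (r - ε) *
              (∑ N ∈ (SquareTower.towerFamily k).ntWindow SquareTower.towerWindow X D χ,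
                harmonicSum (N : ℕ) k (fun f => if rootNumber f = 1 then (1 : ℝ) else 0)) *
              (∑ N ∈ (SquareTower.towerFamily k).ntWindow SquareTower.towerWindow X D χ,
                harmonicSum (N : ℕ) k (fun f => M N f ^ 2 * (centralValue f).re ^ 2)) ≤
            (∑ N ∈ (SquareTower.towerFamily k).ntWindow SquareTower.towerWindow X D χ,
              harmonicSum (N : ℕ) k (fun f => M N f * (centralValue f).re)) ^ 2 ∧
          (Real.log X)⁻¹ ^ 4 *
              (∑ N ∈ (SquareTower.towerFamily k).ntWindow SquareTower.towerWindow X D χ,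
                harmonicSum (N : ℕ) k (fun f => if rootNumber f = 1 then (1 : ℝ) else 0)) *
              (∑ N ∈ (SquareTower.towerFamily k).ntWindow SquareTower.towerWindow X D χ,
                harmonicSum (N : ℕ) k (fun f => M N f ^ 2)) ≤
            ε ^ 2 * (∑ N ∈ (SquareTower.towerFamily k).ntWindow SquareTower.towerWindow X D χ,
              harmonicSum (N : ℕ) k (fun f => M N f * (centralValue f).re)) ^ 2)
    {η : ℝ} (hη : 1 / 2 + η < r) : SquareTower.TowerEdge k η δ :=
  EStarFamLevelAvg_iwaniecSarnakFamilyOn_of_mollifiedMoments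
    (A := fun N => SquareTower.IsTowerLevel ((N : ℕ+) : ℕ)) hk hkev hLR
    ((SquareTower.towerFamily k).windowBound_ntWindow (SquareTower.windowBound_towerWindow k δ)) H hη

end LevelClass

end IwaniecSarnakVocabulary

end Literature.NumberTheory.LFunctions.CentralValueFamilyHalfEdge
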